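import Literature.AlgebraicGeometry.Resolution.GeneralizedStabilityRational
import Literature.AlgebraicGeometry.Resolution.ValuationIndependence
import Literature.AlgebraicGeometry.Resolution.KnafKuhlmann2009Lemma21
import Mathlib.FieldTheory.AlgebraicClosure
import Mathlib.FieldTheory.IsAlgClosed.AlgebraicClosure
import HarnessLib

/-!
# Generalized stability for `K(t)`: algebraically closed ground fields (Kuhlmann 2010, Lemma 5.2)

Topic: `Literature/AlgebraicGeometry/Resolution` (valued function fields). Third layer of the
decomposition of the named fact `Kuhlmann2010Stability` (`ValuationDefect.lean`) = F.-V. Kuhlmann,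
*Elimination of ramification I: The generalized stability theorem*, Trans. AMS 362 (2010)
5697–5727 = arXiv:1003.5678, **Thm. 1.1**, along the printed proof (§5). After
`GeneralizedStability.lean` (Cor. 2.6, Cor. 2.16) and `GeneralizedStabilityRational.lean`
(Lemma 5.1) the theorem over a trivially valued ground field rests on the fundamental inequality
and on `Kuhlmann2010StabilityValueTranscendental` = Thm. 1.1 for `F = K(t)` with `t`
value-transcendental over a defectless `(K, v)` — the case of (R1) that is needed. The second
step of §5 is

> **Lemma 5.2.** To prove (R1), it suffices to prove
> (R2) Every valued function field of transcendence degree 1 without transcendence defect over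
> an algebraically closed field is a defectless field.
> *Proof.* Let `(F|K,v)` satisfy the assumptions of (R1). We pick a valuation-transcendental
> element `t ∈ F`. By Lemma 2.22, `(K(t)|K,v)` is a valuation regular extension, and so is
> `(K̃(t)|K̃,v)` under every extension of `v` to `K̃(t)`. Hence by (R2), `(K̃(t),v)` is a
> defectless field. From Corollary 2.25 we infer that the same holds for `(K(t),v)`. Since
> `F|K(t)` is finite, it follows from Corollary 2.16 that also `(F,v)` is a defectless field.

with

> **Corollary 2.25.** Take a valuation regular extension `(F|K,v)`, fix an extension of `v`
> from `F` to `F̃` and assume that `(K,v)` and `(K̃.F,v)` are defectless fields. Then also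
> `(F,v)` is a defectless field.

(`F̃`, `K̃` the algebraic closures, `K̃.F` "the field compositum … inside of `F̃`", §1.1), and
(§2.4) "An extension `(F|K,v)` of valued fields will be called valuation regular if it is
valuation disjoint from `(K̃|K,v)` in `(F̃,v)` for some extension of `v` from `F` to `F̃`. …
**Lemma 2.20.** An extension `(F|K,v)` is valuation regular if and only if 1) `vF/vK` is torsion
free, 2) `F̄|K̄` is regular." This file PROVES Lemma 5.2 for `F = K(t)`: the hypotheses of
Cor. 2.25 in the form of Lemma 2.20 — `vK(t)/vK = ℤ·vt` is torsion free and `K(t)v = Kv`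
(Lemma 2.5 for one value-transcendental generator, from `ValuationIndependence.lean`: this is
Lemma 2.22 for `𝒯 = {t}`) —, `t` stays value-transcendental over `K̃` (Lemma 2.1: `vK̃/vK` is
a torsion group, `exists_valuation_pow_eq_of_isAlgebraic`), and `K̃.K(t) = K̃(t)`; the two deep
inputs Cor. 2.25 (whose printed proof uses henselizations: Thm. 2.14, Lemma 2.3 of [K6],
Prop. 2.24, Lemma 2.13) and (R2) (Lemmas 5.3–5.4 and the analysis of (R4), §§3–4) are vendored
as named facts.

## Content

* `Kuhlmann2010DefectlessDescent` — NAMED FACT: Cor. 2.25 for an extension `(F|K, v)` with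
  `vF/vK` torsion free and `Fv = Kv` (valuation regular by Lemma 2.20): if `(K, v)` and
  `(K̃.F, v)` (for a fixed extension of `v` to `F̃`) are defectless fields, so is `(F, v)`.
* `Kuhlmann2010StabilityAlgClosedValueTranscendental` — NAMED FACT: (R2) for `F = K(t)`, `K`
  algebraically closed, `t` value-transcendental: `(K(t), v)` is a defectless field.
* `ne_zero_of_valueTranscendental`, `eq_zero_of_valuation_zpow_eq`,
  `exists_valuation_eq_of_valueTranscendental` (**Lemma 2.5 for `K(t)`**: `vK(t) = vK ⊕ ℤvt`,
  every `a ∈ K(t)^×` has `v(a) = v(c)·v(t)^m`, `c ∈ K`, `m ∈ ℤ`),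
  `exists_valuation_eq_of_pow_eq` (`vK(t)/vK` is torsion free),
  `residueSubfield_eq_top_of_valueTranscendental` (`K(t)v = Kv`). PROVED (Lemma 2.22 for
  `𝒯 = {t}` in the form of Lemma 2.20).
* `Kuhlmann2010StabilityValueTranscendental.of_parts :
  Kuhlmann2010DefectlessDescent → Kuhlmann2010StabilityAlgClosedValueTranscendental →
  Kuhlmann2010StabilityValueTranscendental` — Lemma 5.2 for `F = K(t)`, PROVED (extend `v` to
  `F̃` by Chevalley's theorem `exists_valuationSubring_comap_eq`; `K̃ = algebraicClosure K F̃`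
  is algebraically closed; `t` is value-transcendental over `K̃` by Lemma 2.1; (R2) gives
  `(K̃(t), v)` defectless; `K̃.F = K̃(t)`; Cor. 2.25).

Hence `Kuhlmann2010Stability` follows from `FundamentalInequality`,
`Kuhlmann2010DefectlessDescent` and `Kuhlmann2010StabilityAlgClosedValueTranscendental`
(`Kuhlmann2010Stability.of_descent_of_algClosed`).

## Sources

* F.-V. Kuhlmann, *Elimination of ramification I: The generalized stability theorem*, Trans.
  Amer. Math. Soc. 362 (2010) 5697–5727 = arXiv:1003.5678: §1.1 (notation `K̃`, `L.F`), §2.1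
  (Lemma 2.1, Lemma 2.5), §2.4 (valuation disjoint / valuation regular, Lemma 2.19, Lemma 2.20,
  Lemma 2.22, Prop. 2.24, Cor. 2.25), §2.5 (value-transcendental elements), §5 (Lemma 5.2,
  (R1), (R2)).

## Rendering notes

* As before, an extension of valued fields is `[Algebra K F]` plus `O : ValuationSubring F`
  (`K° = O.comap (algebraMap K F)`); "fix an extension of `v` from `F` to `F̃`" is an
  algebraic closure `[IsAlgClosure F Ω]` with `V : ValuationSubring Ω`, `V.comap (algebraMap F Ω)
  = O`; `K̃ ⊆ F̃` is Mathlib's relative algebraic closure `algebraicClosure K Ω` (an algebraic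
  closure of `K`, `algebraicClosure.isAlgClosure`), and the compositum `K̃.F ⊆ F̃` is
  `IntermediateField.adjoin (algebraicClosure K Ω) (Set.range (algebraMap F Ω))` with the
  restriction of `V`.
* "`vF/vK` is torsion free": for `a ∈ F^×` and `n ≥ 1`, `v(a)^n ∈ vK ⇒ v(a) ∈ vK`; "`Fv = Kv`":
  `residueSubfield K O = ⊤`; "`t` value-transcendental over `K`": `∀ n ≥ 1, ∀ c : K,
  v(t)^n ≠ v(c)`, as in `GeneralizedStabilityRational.lean`.
-/

noncomputable section

open IsLocalRing

namespace Literature.AlgebraicGeometry.Resolution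

universe u

/-! ### Cor. 2.25 and (R2) (named facts) -/

/-- NAMED FACT — **Kuhlmann 2010, Cor. 2.25 (descent of defectlessness along a valuation regular
extension), for `vF/vK` torsion free and `Fv = Kv`.** Cor. 2.25: "Take a valuation regular
extension `(F|K,v)`, fix an extension of `v` from `F` to `F̃` and assume that `(K,v)` and
`(K̃.F,v)` are defectless fields. Then also `(F,v)` is a defectless field." Here `F̃`, `K̃`
are the algebraic closures and `K̃.F` is the compositum inside `F̃` (§1.1); "valuation regular"
(§2.4: valuation disjoint from `(K̃|K,v)` in `(F̃,v)`) is supplied through Lemma 2.20: "An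
extension `(F|K,v)` is valuation regular if and only if 1) `vF/vK` is torsion free, 2) `F̄|K̄`
is regular" — vendored in the case `F̄ = K̄` (a trivially regular residue extension), which is
the case of a value-transcendental generator (Lemma 5.2). Statement: `K → F → Ω = F̃` with a
valuation ring `V` of `Ω` inducing `O = F°` on `F` and `K° = O ∩ K` on `K`; if every `a ∈ F^×`
with `n·v(a) ∈ vK` for some `n ≥ 1` has `v(a) ∈ vK`, the residue field of `O` is that of `K°`,
`(K, K°)` is a defectless field and `(K̃.F, V ∩ K̃.F)` is a defectless field, where
`K̃ = algebraicClosure K Ω` and `K̃.F = K̃(F) ⊆ Ω`, then `(F, O)` is a defectless field. The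
printed proof ("From Theorem 2.14 we know that `(K^h,v)` and `((K̃.F)^h,v)` are defectless
fields and that it suffices to prove that `(F^h,v)` is a defectless field … Lemma 2.3 of [K6] …
Corollary 2.21 … Proposition 2.24 … Lemma 2.13") rests on henselizations of valued fields, which
Mathlib does not have. Users take `(h : Kuhlmann2010DefectlessDescent)`.
[cite: Kuhlmann2010, Cor. 2.25 and Lemma 2.20] -/
def Kuhlmann2010DefectlessDescent : Prop :=
  ∀ (K F Ω : Type u) [Field K] [Field F] [Field Ω] [Algebra K F] [Algebra F Ω] [Algebra K Ω]
    [IsScalarTower K F Ω] [IsAlgClosure F Ω] (O : ValuationSubring F) (V : ValuationSubring Ω),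
    V.comap (algebraMap F Ω) = O →
    (∀ a : F, a ≠ 0 → ∀ n : ℕ, 0 < n →
      (∃ c : K, O.valuation a ^ n = O.valuation (algebraMap K F c)) →
      ∃ c : K, O.valuation a = O.valuation (algebraMap K F c)) →
    residueSubfield K O = ⊤ →
    IsDefectlessField K (O.comap (algebraMap K F)) →
    IsDefectlessField (IntermediateField.adjoin (algebraicClosure K Ω) (Set.range (algebraMap F Ω)))
      (V.comap (algebraMap
        (IntermediateField.adjoin (algebraicClosure K Ω) (Set.range (algebraMap F Ω))) Ω)) →
    IsDefectlessField F O

/-- NAMED FACT — **Kuhlmann 2010, (R2) for a valued rational function field with a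
value-transcendental generator over an algebraically closed field** (§5, Lemma 5.2: "(R2) Every
valued function field of transcendence degree 1 without transcendence defect over an
algebraically closed field is a defectless field"; §2.5: "a value-transcendental element
`x ∈ F`, i.e., its value `vx` is rationally independent over `vK` … `x` is transcendental over
`K` by Lemma 2.5, hence `F|K(x)` is finite"). Statement: `K` algebraically closed with an
arbitrary valuation ring `F° ∩ K`, `F = K(t)` with `n·vt ∉ vK` for all `n ≥ 1`; then `(F|K, v)`
is a valued rational function field of transcendence degree `1 = rr vF/vK` without
transcendence defect (Lemma 2.5), and (R2) says that `(F, F°)` is a defectless field. Its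
printed proof is Lemmas 5.3–5.4 ((R2) ⇐ (R3) ⇐ (R4): reduction to finite rank through the
henselization `K(t)^h` and Prop. 2.24, to rank `1` through composite valuations, Lemmas 2.8 and
2.17) and the proof of (R4) (ramification theory, Lemma 2.27, Prop. 2.18, Prop. 3.1, Cor. 4.2 —
the Artin–Schreier and Kummer normal forms of §4 —, Lemma 5.5), not available in Mathlib.
Users take `(h : Kuhlmann2010StabilityAlgClosedValueTranscendental)`.
[cite: Kuhlmann2010, Section 5, Lemma 5.2 (R2)] -/
def Kuhlmann2010StabilityAlgClosedValueTranscendental : Prop :=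
  ∀ (K F : Type u) [Field K] [Field F] [Algebra K F] [IsAlgClosed K] (O : ValuationSubring F)
    (t : F), (∀ n : ℕ, 0 < n → ∀ c : K, O.valuation t ^ n ≠ O.valuation (algebraMap K F c)) →
    IntermediateField.adjoin K ({t} : Set F) = ⊤ → IsDefectlessField F O

/-! ### Lemma 2.5 / Lemma 2.22 for one value-transcendental generator -/

section ValueTranscendental

variable {K F : Type u} [Field K] [Field F] [Algebra K F] (O : ValuationSubring F) {t : F}
  (hvt : ∀ n : ℕ, 0 < n → ∀ c : K, O.valuation t ^ n ≠ O.valuation (algebraMap K F c))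

include hvt

/-- A value-transcendental element is non-zero (`v(0)^1 = v(0)`). [folklore] -/
theorem ne_zero_of_valueTranscendental : t ≠ 0 := by
  intro ht
  apply hvt 1 one_pos 0
  rw [ht, map_zero, map_zero, map_zero, pow_one]

/-- Rational independence of `vt` over `vK` with integer exponents: `v(t)^m = v(c)`, `m ∈ ℤ`,
`c ∈ K`, forces `m = 0`. [folklore] -/
theorem eq_zero_of_valuation_zpow_eq (m : ℤ) (c : K)
    (h : O.valuation t ^ m = O.valuation (algebraMap K F c)) : m = 0 := by
  have ht0 : O.valuation t ≠ 0 :=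
    valuation_ne_zero_of_ne_zero O (ne_zero_of_valueTranscendental O hvt)
  rcases lt_trichotomy m 0 with hm | rfl | hm
  · exfalso
    apply hvt (-m).toNat (by omega) c⁻¹
    rw [map_inv₀, map_inv₀, ← h, ← zpow_natCast, Int.toNat_of_nonneg (by omega), zpow_neg]
  · rfl
  · exfalso
    apply hvt m.toNat (by omega) c
    rw [← h, ← zpow_natCast, Int.toNat_of_nonneg hm.le]

/-- The hypotheses of `ValuationIndependence.lean` (Knaf–Kuhlmann 2005, Thm. 2.1 = Kuhlmann
2010, Lemma 2.5) for the one-element system `x = (t)`, `y = ∅` over the subfield `K ⊆ F`.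
[folklore] -/
theorem valueTranscendental_hxi (m : Fin 1 → ℤ)
    (hm : ∃ b ∈ (algebraMap K F).fieldRange,
      (∏ i, O.valuation ((fun _ : Fin 1 => t) i) ^ m i) = O.valuation b) : m = 0 := by
  obtain ⟨_, ⟨c, rfl⟩, hb⟩ := hm
  rw [Fin.prod_univ_one] at hb
  funext i
  rw [Subsingleton.elim i 0]
  exact eq_zero_of_valuation_zpow_eq O hvt (m 0) c hb

omit hvt in
/-- `K(t)` is the subfield generated by `K` and `t` (the ambient form of
`IntermediateField.adjoin K {t} = ⊤`). [folklore] -/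
theorem mem_closure_of_adjoin_eq_top (hgen : IntermediateField.adjoin K ({t} : Set F) = ⊤)
    (a : F) :
    a ∈ Subfield.closure (((algebraMap K F).fieldRange : Set F) ∪
      (Set.range (fun _ : Fin 1 => t) ∪ Set.range (Fin.elim0 : Fin 0 → F))) := by
  have ha : a ∈ IntermediateField.adjoin K ({t} : Set F) := by
    rw [hgen]
    exact IntermediateField.mem_top
  rw [Set.range_eq_empty (Fin.elim0 : Fin 0 → F), Set.union_empty, Set.range_const,
    RingHom.coe_fieldRange]
  exact ha

/-- **Kuhlmann 2010, Lemma 2.5 for `K(t)`, value group: `vK(t) = vK ⊕ ℤ·vt`.** If `t` is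
value-transcendental over `K` and `F = K(t)`, then every `a ∈ F^×` has
`v(a) = v(c) · v(t)^m` for some `c ∈ K` and `m ∈ ℤ` ("the value of the polynomial `f` is
equal to the least of the values of its monomials. In particular, this implies:
`vK(xᵢ, yⱼ | i ∈ I, j ∈ J) = vK ⊕ ⊕_{i∈I} ℤvxᵢ`"). PROVED from the ambient version
`exists_valuation_eq_of_mem_closure` (`ValuationIndependence.lean`).
[cite: Kuhlmann2010, Lemma 2.5] -/
theorem exists_valuation_eq_of_valueTranscendental
    (hgen : IntermediateField.adjoin K ({t} : Set F) = ⊤) {a : F} (ha0 : a ≠ 0) :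
    ∃ (m : ℤ) (c : K), O.valuation a = O.valuation (algebraMap K F c) * O.valuation t ^ m := by
  classical
  have hx0 : ∀ i : Fin 1, (fun _ : Fin 1 => t) i ≠ 0 := fun _ =>
    ne_zero_of_valueTranscendental O hvt
  have hy : ∀ j : Fin 0, (Fin.elim0 : Fin 0 → F) j ∈ O := fun j => j.elim0
  have hri : AlgebraicIndependent (resField O (algebraMap K F).fieldRange)
      (fun j : Fin 0 => residue O ⟨(Fin.elim0 : Fin 0 → F) j, hy j⟩) :=
    algebraicIndependent_empty_type
  obtain ⟨m, _, ⟨c, rfl⟩, hv⟩ := exists_valuation_eq_of_mem_closure O (algebraMap K F).fieldRange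
    hx0 (valueTranscendental_hxi O hvt) hy hri (mem_closure_of_adjoin_eq_top hgen a) ha0
  refine ⟨m 0, c, ?_⟩
  rw [hv, Fin.prod_univ_one]

/-- **Kuhlmann 2010, Lemma 2.22 for `𝒯 = {t}`, value part: `vK(t)/vK` is torsion free**
(condition 1 of Lemma 2.20): if `a ∈ K(t)^×` and `v(a)^n ∈ vK` for some `n ≥ 1`, then
`v(a) ∈ vK` (write `v(a) = v(c₀)·v(t)^m`; then `v(t)^{mn} ∈ vK`, so `m = 0`). PROVED.
[cite: Kuhlmann2010, Lemma 2.22 and Lemma 2.20] -/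
theorem exists_valuation_eq_of_pow_eq (hgen : IntermediateField.adjoin K ({t} : Set F) = ⊤)
    {a : F} (ha0 : a ≠ 0) {n : ℕ} (hn : 0 < n)
    (h : ∃ c : K, O.valuation a ^ n = O.valuation (algebraMap K F c)) :
    ∃ c : K, O.valuation a = O.valuation (algebraMap K F c) := by
  obtain ⟨m, c₀, hv⟩ := exists_valuation_eq_of_valueTranscendental O hvt hgen ha0
  obtain ⟨c, hc⟩ := h
  have hc₀0 : O.valuation (algebraMap K F c₀) ≠ 0 := by
    intro h0
    rw [h0, zero_mul] at hv
    exact valuation_ne_zero_of_ne_zero O ha0 hv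
  have key : O.valuation t ^ (m * n) = O.valuation (algebraMap K F (c / c₀ ^ n)) := by
    rw [map_div₀, map_pow, map_div₀, map_pow, ← hc, hv, mul_pow, ← zpow_natCast, ← zpow_natCast,
      ← zpow_mul, mul_div_cancel_left₀ _ (zpow_ne_zero _ hc₀0)]
  have hm : m * n = 0 := eq_zero_of_valuation_zpow_eq O hvt _ _ key
  have hm0 : m = 0 := by
    rcases mul_eq_zero.mp hm with h | h
    · exact h
    · omega
  refine ⟨c₀, ?_⟩
  rw [hv, hm0, zpow_zero, mul_one]

/-- **Kuhlmann 2010, Lemma 2.5 for `K(t)`, residue field: `K(t)v = Kv`** (condition 2 of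
Lemma 2.20 for Lemma 2.22 with `𝒯 = {t}`: "`K(xᵢ, yⱼ | i ∈ I, j ∈ J)v = Kv(yⱼv | j ∈ J)`" with
`J = ∅`): every residue of `K(t)°` is the residue of an element of `K`. PROVED from the ambient
version `residue_mem_closure_of_mem_closure` (`ValuationIndependence.lean`).
[cite: Kuhlmann2010, Lemma 2.5] -/
theorem residueSubfield_eq_top_of_valueTranscendental
    (hgen : IntermediateField.adjoin K ({t} : Set F) = ⊤) : residueSubfield K O = ⊤ := by
  classical
  refine eq_top_iff.mpr fun r _ => ?_
  obtain ⟨a, rfl⟩ := residue_surjective r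
  have hx0 : ∀ i : Fin 1, (fun _ : Fin 1 => t) i ≠ 0 := fun _ =>
    ne_zero_of_valueTranscendental O hvt
  have hy : ∀ j : Fin 0, (Fin.elim0 : Fin 0 → F) j ∈ O := fun j => j.elim0
  have hri : AlgebraicIndependent (resField O (algebraMap K F).fieldRange)
      (fun j : Fin 0 => residue O ⟨(Fin.elim0 : Fin 0 → F) j, hy j⟩) :=
    algebraicIndependent_empty_type
  have hmem := residue_mem_closure_of_mem_closure O (algebraMap K F).fieldRange hx0
    (valueTranscendental_hxi O hvt) hy hri (mem_closure_of_adjoin_eq_top hgen (a : F)) a.2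
  rw [Set.range_eq_empty, Set.union_empty, Subfield.closure_eq] at hmem
  obtain ⟨b, ⟨c, hc⟩, hb⟩ := (mem_resField_iff O _ _).mp hmem
  rw [mem_residueSubfield_iff]
  have hcO : algebraMap K F c ∈ O := by
    rw [hc]
    exact b.2
  refine ⟨c, hcO, ?_⟩
  have hbc : (⟨algebraMap K F c, hcO⟩ : O) = b := Subtype.ext hc
  rw [hbc, hb]

end ValueTranscendental

/-! ### Lemma 5.2 for `F = K(t)`: reduction to an algebraically closed ground field -/

/-- **Kuhlmann 2010, Thm. 1.1 for `K(t)` with `t` value-transcendental, from Cor. 2.25 and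
(R2)** (Lemma 5.2: "We pick a valuation-transcendental element `t ∈ F`. By Lemma 2.22,
`(K(t)|K,v)` is a valuation regular extension, and so is `(K̃(t)|K̃,v)` under every extension
of `v` to `K̃(t)`. Hence by (R2), `(K̃(t),v)` is a defectless field. From Corollary 2.25 we
infer that the same holds for `(K(t),v)`"). PROVED: extend `v` from `F = K(t)` to the algebraic
closure `Ω = F̃` (Chevalley, `exists_valuationSubring_comap_eq`); `K̃ = algebraicClosure K Ω` is
algebraically closed; `t` is value-transcendental over `K̃` (if `v(t)^n = v(c)` with `c ∈ K̃^×`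
then `v(c)^m ∈ vK` for some `m ≥ 1` by Lemma 2.1, `exists_valuation_pow_eq_of_isAlgebraic`, so
`v(t)^{nm} ∈ vK`); (R2) makes `(K̃(t), v)` defectless; `K̃.F = K̃(t)` inside `Ω`; and
`vF/vK` is torsion free with `Fv = Kv` (`exists_valuation_eq_of_pow_eq`,
`residueSubfield_eq_top_of_valueTranscendental` = Lemma 2.22), so Cor. 2.25 applies.
[cite: Kuhlmann2010, Section 5, Lemma 5.2] -/
theorem Kuhlmann2010StabilityValueTranscendental.of_parts
    (hA : Kuhlmann2010DefectlessDescent.{u})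
    (hB : Kuhlmann2010StabilityAlgClosedValueTranscendental.{u}) :
    Kuhlmann2010StabilityValueTranscendental.{u} := by
  intro K F _ _ _ O t hvt hgen hK
  classical
  have ht0 : t ≠ 0 := ne_zero_of_valueTranscendental O hvt
  -- fix an extension `V` of `v` to the algebraic closure `Ω = F̃`
  obtain ⟨V, hV⟩ := exists_valuationSubring_comap_eq (Ω := AlgebraicClosure F) O
  subst hV
  set Ω : Type u := AlgebraicClosure F with hΩ
  -- `K̃ ⊆ Ω`, an algebraic closure of `K`
  set Kt : IntermediateField K Ω := algebraicClosure K Ω with hKt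
  haveI : IsAlgClosed Kt := IsAlgClosure.isAlgClosed K
  -- `K̃(t) ⊆ Ω` with the restriction of `V`
  set t' : Ω := algebraMap F Ω t with ht'
  set M : IntermediateField Kt Ω := IntermediateField.adjoin Kt ({t'} : Set Ω) with hM
  have ht'mem : t' ∈ M := IntermediateField.subset_adjoin _ _ rfl
  have ht'0 : t' ≠ 0 := (map_ne_zero (algebraMap F Ω)).mpr ht0
  -- (R2): `(K̃(t), v)` is a defectless field
  have hMdef : IsDefectlessField M (V.comap (algebraMap M Ω)) := by
    refine hB Kt M (V.comap (algebraMap M Ω)) ⟨t', ht'mem⟩ ?_ ?_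
    · -- `t` is value-transcendental over `K̃` (Lemma 2.1)
      intro n hn c h
      have h' : V.valuation t' ^ n = V.valuation ((c : Kt) : Ω) := by
        have h1 := congrArg (valueGroupHom M V) h
        rw [map_pow, valueGroupHom_valuation, valueGroupHom_valuation] at h1
        exact h1
      have hc0 : ((c : Kt) : Ω) ≠ 0 := by
        intro hc
        rw [hc, map_zero] at h'
        exact pow_ne_zero n (valuation_ne_zero_of_ne_zero V ht'0) h'
      -- `c` is algebraic over `K ⊆ Ω`
      have halg : IsAlgebraic K ((c : Kt) : Ω) := mem_algebraicClosure_iff.mp c.2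
      letI : Algebra K (algebraMap K Ω).fieldRange := (algebraMap K Ω).rangeRestrictField.toAlgebra
      haveI : IsScalarTower K (algebraMap K Ω).fieldRange Ω :=
        IsScalarTower.of_algebraMap_eq fun _ => rfl
      have halg' : IsAlgebraic (algebraMap K Ω).fieldRange ((c : Kt) : Ω) :=
        halg.extendScalars (algebraMap K (algebraMap K Ω).fieldRange).injective
      obtain ⟨m, hm0, _, ⟨d, rfl⟩, hmd⟩ := exists_valuation_pow_eq_of_isAlgebraic V halg' hc0
      -- `v(t)^{nm} = v(d)` with `d ∈ K`: impossible
      refine hvt (n * m) (Nat.mul_pos hn (Nat.pos_of_ne_zero hm0)) d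
        (valueGroupHom_injective F V ?_)
      rw [map_pow, valueGroupHom_valuation, valueGroupHom_valuation, pow_mul, ← ht', h',
        ← map_pow, hmd, ← IsScalarTower.algebraMap_apply]
    · -- `K̃(t)` is generated over `K̃` by `t`
      apply IntermediateField.lift_injective M
      rw [IntermediateField.lift_adjoin, IntermediateField.lift_top, Set.image_singleton]
  -- `K̃.F = K̃(t)`
  have hMeq : IntermediateField.adjoin Kt (Set.range (algebraMap F Ω)) = M := by
    apply le_antisymm
    · rw [IntermediateField.adjoin_le_iff]
      rintro _ ⟨a, rfl⟩
      have ha : a ∈ IntermediateField.adjoin K ({t} : Set F) := by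
        rw [hgen]
        exact IntermediateField.mem_top
      let φ : F →ₐ[K] Ω := IsScalarTower.toAlgHom K F Ω
      have h1 : φ a ∈ (IntermediateField.adjoin K ({t} : Set F)).map φ := ⟨a, ha, rfl⟩
      rw [IntermediateField.adjoin_map, Set.image_singleton] at h1
      have hle : IntermediateField.adjoin K ({φ t} : Set Ω) ≤ M.restrictScalars K :=
        IntermediateField.adjoin_le_iff.mpr (Set.singleton_subset_iff.mpr ht'mem)
      exact hle h1
    · exact IntermediateField.adjoin.mono _ _ _ (Set.singleton_subset_iff.mpr ⟨t, rfl⟩)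
  -- Cor. 2.25
  refine hA K F Ω (V.comap (algebraMap F Ω)) V rfl
    (fun a ha0 n hn h => exists_valuation_eq_of_pow_eq _ hvt hgen ha0 hn h)
    (residueSubfield_eq_top_of_valueTranscendental _ hvt hgen) hK ?_
  rw [hMeq]
  exact hMdef

/-! ### Assembly -/

/-- **Kuhlmann 2010, Thm. 1.1 over a trivially valued ground field** from the fundamental
inequality (1), Cor. 2.25 and (R2) for `K̃(t)`: `Kuhlmann2010Stability.of_valueTranscendental`
(Cor. 2.6, Cor. 2.16, Lemma 5.1) composed with Lemma 5.2
(`Kuhlmann2010StabilityValueTranscendental.of_parts`). PROVED.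
[cite: Kuhlmann2010, Thm. 1.1, Section 5, Lemmas 5.1–5.2] -/
theorem Kuhlmann2010Stability.of_descent_of_algClosed (hFI : FundamentalInequality.{u})
    (hA : Kuhlmann2010DefectlessDescent.{u})
    (hB : Kuhlmann2010StabilityAlgClosedValueTranscendental.{u}) : Kuhlmann2010Stability.{u} :=
  Kuhlmann2010Stability.of_valueTranscendental hFI
    (Kuhlmann2010StabilityValueTranscendental.of_parts hA hB)

end Literature.AlgebraicGeometry.Resolution
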